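import Summits.ResolutionOfSingularities.ResolutionOfSingularities.Theorems.MarkedTransferCampaignW24ReducedBridgeRun
import HarnessLib

/-!
# The REDUCED ↔ MULTIVARIATE bridge, positive direction: in-box reduced EXHAUSTION gives `StaysInBox` and a legal
# exhausting run for `Φ G₀ = x·G₀(x²)` (HIRONAKA-L, slot W2.4 class-restricted residual; cell `res-hironaka`; OURS kernel support)

**HONEST FRAMING.** Everything here is OURS (cell `res-hironaka`, slot W2.4 «bottom-member re-run» = L-47B-s1): kernel
theorems connecting the MULTIVARIATE legal run `CampaignW24.IsBottomRun` / `StaysInBox` (p503230 / p507038) with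
res-L1-k24's REDUCED MODEL `ReducedRun.canonRun` (p508772 / p509286), companion of `MarkedTransferCampaignW24ReducedBridgeRun.lean`
(negative direction: escape ⟹ `¬ StaysInBox`). Nothing below is a statement of H. Hironaka's manuscript *Resolution of
singularities in positive characteristics* [Hironaka2017] (lit key `paper:url-3343fd9e678b`), nothing asserts that any
statement of it holds; the manuscript stays «under review» (D-0012/D-0089). AI work, weaker than expert review.

## What is proved (p = 2, e = 1, n = 1; depth `ℓ ≥ 1`, `P = 2^{ℓ−1}`)

If the canonical reduced Case-(I) run from `G₀` is EXHAUSTED IN THE BOX at stage `i₁` — states `canonRun P G₀ i`, `i < i₁`,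
non-zero of order `k_i` with `2 ≤ k_i < P`, and `canonRun P G₀ i₁ = 0` — then every legal depth-`ℓ` run from `Φ G₀` is
`Φ ∘ canonRun` of length `≤ i₁` (`run_eq_phi_canonRun_of_exhaustion`), the bottom exponent stays in the box along every
legal run (`staysInBox_of_reduced_exhaustion` — the class-restricted residual INSTANCE for this `ε`, by name), and over a
perfect field a legal run from `Φ G₀` reaches lower class (`exhausts_of_reduced_exhaustion`, via res-D-pv-020's
`exhausts_of_staysInBox` p508885). Consumers: res-L1-k24's exhausting reduced families with bottom digits `≥ 2`
(e.g. `canonRun_kappa_exhausts`). Hypotheses: each theorem's own binders. Written by res-D-pv-020 AS res-L1-s24b-pv-1.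
Standard axioms only.
-/

noncomputable section

set_option linter.dupNamespace false -- mandated namespace of this single-conjunct summit

namespace Summit.ResolutionOfSingularities.ResolutionOfSingularities.Theorems

namespace CampaignW24

namespace ReducedBridge

open Literature.AlgebraicGeometry.Hironaka2017.S08UnitMonomial (StandardExpression)
open Literature.AlgebraicGeometry.Hironaka2017.S09LLUED
open Literature.AlgebraicGeometry.Hironaka2017.S09LLUED.TopFrontier
open Literature.AlgebraicGeometry.Hironaka2017.S09LLUED.TopDeriv
open Literature.AlgebraicGeometry.Resolution (adicOrder)
open Literature.RingTheory.MvPowerSeries (adicOrder_eq_order)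
open CampaignW21 (xs hasseD)

variable {K : Type} [Field K] [CharP K 2]

omit [CharP K 2] in
/-- `Φ 0 = 0`. [folklore] -/
theorem phi_zero : phi (0 : PowerSeries K) = 0 := by
  rw [phi, map_zero, mul_zero]

/-- A datum of `0` has an empty top block (else its bottom monomial would have a non-zero coefficient). [folklore] -/
theorem frontierLength_eq_zero_of_eq_zero {ℓ : ℕ} (hℓ : 1 ≤ ℓ) {F : MvPowerSeries (Fin 1) K}
    (X : StandardExpression 2 (xs K 1) 1 ℓ F) (hF : F = 0) : frontierLength X.support X.u = 0 := by
  subst hF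
  by_contra h0
  have h := coeff_bottomExp_ne_zero X Nat.one_pos hℓ (Nat.pos_of_ne_zero h0)
  rw [map_zero] at h
  exact h rfl

/-- **Run bridge under in-box exhaustion.** If the reduced run is non-zero of order `≥ 2` before stage `i₁` and ZERO at
stage `i₁`, every legal depth-`ℓ` run from `Φ G₀` has length `≤ i₁` and IS `Φ ∘ canonRun 2^{ℓ−1} G₀`. [folklore] -/
theorem run_eq_phi_canonRun_of_exhaustion {ℓ : ℕ} (hℓ : 1 ≤ ℓ) {G₀ : PowerSeries K} {N : ℕ}
    {εs : ℕ → MvPowerSeries (Fin 1) K} (h0 : εs 0 = phi G₀) (hrun : IsBottomRun 2 1 ℓ εs N) {i₁ : ℕ}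
    (hpre : ∀ i < i₁, ReducedRun.canonRun (2 ^ (ℓ - 1)) G₀ i ≠ 0 ∧
      (2 : ℕ∞) ≤ PowerSeries.order (ReducedRun.canonRun (2 ^ (ℓ - 1)) G₀ i))
    (hzero : ReducedRun.canonRun (2 ^ (ℓ - 1)) G₀ i₁ = 0) :
    ∀ i ≤ N, i ≤ i₁ ∧ εs i = phi (ReducedRun.canonRun (2 ^ (ℓ - 1)) G₀ i) := by
  intro i
  induction i with
  | zero => exact fun _ => ⟨Nat.zero_le _, h0⟩
  | succ i ih =>
    intro hi
    obtain ⟨hii₁, hεi⟩ := ih (Nat.le_of_succ_le hi)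
    obtain ⟨X, w, c, hX0, hsole, hbox, hw, hstep⟩ := hrun i hi
    rcases Nat.lt_or_ge i i₁ with hlt | hge
    · obtain ⟨hne, h2⟩ := hpre i hlt
      have hfin : PowerSeries.order (ReducedRun.canonRun (2 ^ (ℓ - 1)) G₀ i) =
          ((PowerSeries.order (ReducedRun.canonRun (2 ^ (ℓ - 1)) G₀ i)).toNat : ℕ∞) :=
        (ENat.coe_toNat fun h => hne (PowerSeries.order_eq_top.mp h)).symm
      have h2k : 2 ≤ (PowerSeries.order (ReducedRun.canonRun (2 ^ (ℓ - 1)) G₀ i)).toNat := by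
        rw [hfin] at h2
        exact_mod_cast h2
      refine ⟨hlt, ?_⟩
      rw [hstep, stepAt_eq_phi_canonStepI X hεi hℓ hX0 hfin h2k hsole hw c]
      rfl
    · exfalso
      have heq : i = i₁ := le_antisymm hii₁ hge
      subst heq
      have hF0 : εs i = 0 := by rw [hεi, hzero, phi_zero]
      have := frontierLength_eq_zero_of_eq_zero hℓ X hF0
      omega

/-- **Box-confinement from in-box reduced exhaustion** — the class-restricted residual BY NAME for `ε = Φ G₀`:
`StaysInBox 2 1 ℓ X₀` for every reference datum `X₀` (in-box states `i < i₁` have bottom digit `k_i < 2^{ℓ−1}`, and the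
state `i₁` is `0`, of lower class). [folklore] -/
theorem staysInBox_of_reduced_exhaustion {ℓ₀ ℓ : ℕ} (hℓ : 1 ≤ ℓ) {G₀ : PowerSeries K} {F₀ : MvPowerSeries (Fin 1) K}
    (X₀ : StandardExpression 2 (xs K 1) 1 ℓ₀ F₀) (hF₀ : F₀ = phi G₀) {i₁ : ℕ}
    (hpre : ∀ i < i₁, ReducedRun.canonRun (2 ^ (ℓ - 1)) G₀ i ≠ 0 ∧
      (2 : ℕ∞) ≤ PowerSeries.order (ReducedRun.canonRun (2 ^ (ℓ - 1)) G₀ i) ∧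
      PowerSeries.order (ReducedRun.canonRun (2 ^ (ℓ - 1)) G₀ i) < ((2 ^ (ℓ - 1) : ℕ) : ℕ∞))
    (hzero : ReducedRun.canonRun (2 ^ (ℓ - 1)) G₀ i₁ = 0) :
    StaysInBox 2 1 ℓ X₀ := by
  subst hF₀
  intro N εs h0 hrun hnl X hX0
  obtain ⟨hN, hεN⟩ := run_eq_phi_canonRun_of_exhaustion hℓ h0 hrun (fun i hi => ⟨(hpre i hi).1, (hpre i hi).2.1⟩)
    hzero N le_rfl
  rcases Nat.lt_or_ge N i₁ with hlt | hge
  · obtain ⟨hne, -, hP⟩ := hpre N hlt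
    have hfin : PowerSeries.order (ReducedRun.canonRun (2 ^ (ℓ - 1)) G₀ N) =
        ((PowerSeries.order (ReducedRun.canonRun (2 ^ (ℓ - 1)) G₀ N)).toNat : ℕ∞) :=
      (ENat.coe_toNat fun h => hne (PowerSeries.order_eq_top.mp h)).symm
    rw [hfin] at hP
    exact (depthBox_iff X hεN hℓ hX0 hfin).mpr (by exact_mod_cast hP)
  · exfalso
    have hF0 : εs N = 0 := by rw [hεN, le_antisymm hN hge, hzero, phi_zero]
    have := frontierLength_eq_zero_of_eq_zero hℓ X hF0
    omega

/-- **Exhaustion from in-box reduced exhaustion** (perfect `K`, `G₀(0) = 0`, reference datum `X₀` of `Φ G₀` of depth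
`ℓ₀`, `1 ≤ ℓ₀ ≤ ℓ`, non-empty top block): a legal depth-`ℓ` bottom-member run from `Φ G₀` reaches lower class — the
(c∃)-instance for this `ε`, by name, via `exhausts_of_staysInBox` (p508885). [folklore] -/
theorem exhausts_of_reduced_exhaustion [ExpChar K 2] [PerfectRing K 2] {ℓ₀ ℓ : ℕ} (hℓ₀ : 1 ≤ ℓ₀) (hℓ : ℓ₀ ≤ ℓ)
    {G₀ : PowerSeries K} (hG₀0 : PowerSeries.constantCoeff G₀ = 0) {F₀ : MvPowerSeries (Fin 1) K}
    (X₀ : StandardExpression 2 (xs K 1) 1 ℓ₀ F₀) (hF₀ : F₀ = phi G₀) (h00 : 0 < frontierLength X₀.support X₀.u)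
    {i₁ : ℕ}
    (hpre : ∀ i < i₁, ReducedRun.canonRun (2 ^ (ℓ - 1)) G₀ i ≠ 0 ∧
      (2 : ℕ∞) ≤ PowerSeries.order (ReducedRun.canonRun (2 ^ (ℓ - 1)) G₀ i) ∧
      PowerSeries.order (ReducedRun.canonRun (2 ^ (ℓ - 1)) G₀ i) < ((2 ^ (ℓ - 1) : ℕ) : ℕ∞))
    (hzero : ReducedRun.canonRun (2 ^ (ℓ - 1)) G₀ i₁ = 0) :
    ∃ (N : ℕ) (εs : ℕ → MvPowerSeries (Fin 1) K), εs 0 = F₀ ∧ IsBottomRun 2 1 ℓ εs N ∧ IsLowerClass X₀ (εs N) := by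
  haveI : PerfectField K := PerfectRing.toPerfectField K 2
  have hstay := staysInBox_of_reduced_exhaustion (le_trans hℓ₀ hℓ) X₀ hF₀ hpre hzero
  subst hF₀
  have hα : alpha X₀.support X₀.u ≠ 0 := by
    rw [(alpha_eq_single X₀ rfl hℓ₀ h00).1]
    exact Finsupp.single_ne_zero.mpr one_ne_zero
  have hord : ((2 ^ 1 : ℕ) : ℕ∞) < adicOrder (phi G₀) := by
    rw [adicOrder_eq_order]
    exact lt_of_lt_of_le (by decide) (three_le_order_phi hG₀0)
  exact exhausts_of_staysInBox X₀ Nat.one_pos hℓ₀ h00 hα hord hℓ hstay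

end ReducedBridge

end CampaignW24

end Summit.ResolutionOfSingularities.ResolutionOfSingularities.Theorems

end
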